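import Summits.CriticalPhenomena.PercolationContinuityZ3.Theorems.Transplant.FKConnectivityAllQAntipodalFoldLemmas
import HarnessLib

/-!
# Connectivity correlation inequalities for `φ_{w,q}`, every `q > 0` — file 38b: **PRUNING A SUB-NETWORK TO ITS CORE** — the
# dangling parts of `L ⊆ E` (E two-terminal series–parallel) fold into the test function; what remains is a two-terminal
# series–parallel core `L' ⊆ L` (or nothing, when `L` has no terminal path)

Support file (`--supports stmt-CriticalPhenomena-4575`), FK sub-lane `prim-bschramm-fk-2` (gen 20); builds on p205010 (kernel theorem,
internal audit signed; external expert review pending).  No definitions, no named facts, no sorries; standard axioms.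

A DELETION CELL of gen 10's Conjecture `C_∞` on the host `H = E ∪ {st}` is the top cell of `L ∪ {st}` for a live set `L ⊆ E`; when
`L ∪ {st}` is 2-connected it is literally a top cell of a smaller 2-connected series–parallel graph, and otherwise the parts of `L` hanging
off cut vertices must be folded away (file 36's one-sum fold).  This file does the folding ALONG THE DERIVATION of `E`, with no block
decomposition: **`FK.prune`** — for `E` TTSP between `s, t` (derivation `hE`), `q ≠ 0` and every `L ⊆ E` there is `L' ⊆ L` with
(i) `L'` TTSP between `s, t`, or `L' = ∅`; (ii) no `s–t` path inside `L ∖ L'`; (iii) THE FOLD IDENTITY: for every context `K` (an edge set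
disjoint from `E` whose vertex support meets that of `E` inside `{s, t}`), every `f` not reading `L ∖ L'` and every `G`,
`q^{2|V|} · apPsi q (K ∪ L) f G = apPsi q (K ∪ L') f (Ĝ)`, `Ĝ(β) = Σ_{δ ⊆ L∖L'} q^{k(δ)+k((L∖L')∖δ)} G(β ∪ δ)`
— the pruned part carries ONE antipodal weight (its pieces are one-sums of each other, or parallel pairs without terminal paths, so
`FK.apExp_series` / `FK.apExp_parallel` add up with vanishing junction terms).  Ingredients (file 38a): `FK.apPsi_fold_eq_of_add` (the fold under an
abstract additivity of the antipodal exponent; file 36's `apPsi_oneSum_eq` is its one-vertex instance), `FK.apPsi_twoPoint_eq` (two shared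
vertices but no path between them in the folded part), `FK.fold_fold` (composition of folds), `FK.fold_empty`.
File 39 uses `FK.prune` to put U¹¹, `maj₃` and level ≤ 3 into EVERY deletion cell (every square-free coefficient).
[cite: Grimmett2006, §1.4 eq. (1.20) (p. 15); §3.8 Thm. (3.90) (pp. 61–62)] [cite: Wagner2006, Thm. 5.8(d), §5.3]
-/

noncomputable section

namespace Summit.CriticalPhenomena.PercolationContinuityZ3.Theorems

namespace FK

open Literature.Probability.LatticeModels Literature.Probability.Percolation
open scoped Classical

variable {V : Type*} [Fintype V]

/-! ### Pruning -/

section Prune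

/-- **PRUNING TO THE CORE.**  `E` two-terminal series–parallel between `s, t`, `q ≠ 0`.  For every `L ⊆ E` there is `L' ⊆ L` such that:
(i) `L'` is two-terminal series–parallel between `s, t`, or `L' = ∅`; (ii) `L ∖ L'` contains no `s–t` path; (iii) for every context `K`
disjoint from `E` with a vertex support `VK` meeting the vertices of `E` inside `{s, t}`, every `f` not reading `L ∖ L'` and every `G`:
`q^{2|V|} · apPsi q (K ∪ L) f G = apPsi q (K ∪ L') f (β ↦ Σ_{δ ⊆ L∖L'} q^{k(δ)+k((L∖L')∖δ)} G(β ∪ δ))`.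
Proof by induction on the derivation: an edge is its own core or empty; at a series node the two sub-prunings compose
(`FK.fold_fold` + `FK.apExp_series`) unless one side has an empty core, in which case the other side hangs at one terminal and folds away
whole (`FK.apPsi_fold_eq_of_add`); at a parallel node both sub-prunings compose through `FK.apExp_add_twoPoint` (no terminal path in the
pruned parts). [cite: Grimmett2006, §3.8 Thm. (3.90) (pp. 61–62)] -/
theorem prune {q : ℝ} (hq : q ≠ 0) {E : Finset (Sym2 V)} {s t : V} (hE : IsTTSP E s t) :
    ∀ L : Finset (Sym2 V), L ⊆ E → ∃ L' : Finset (Sym2 V), L' ⊆ L ∧ (IsTTSP L' s t ∨ L' = ∅) ∧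
      ¬ (openGraph (↑(L \ L') : BondConfig V)).Reachable s t ∧
      ∀ (K : Finset (Sym2 V)) (VK : Set V), Disjoint K E → (∀ e ∈ (↑K : Set (Sym2 V)), ∀ v ∈ e, v ∈ VK) →
        VK ∩ {v : V | ∃ e ∈ E, v ∈ e} ⊆ {s, t} →
        ∀ f : Finset (Sym2 V) → ℝ, (∀ X Y : Finset (Sym2 V), Y ⊆ L \ L' → f (X ∪ Y) = f X) →
        ∀ G : Finset (Sym2 V) → ℝ,
          q ^ (2 * Fintype.card V) * apPsi q (K ∪ L) f G =
            apPsi q (K ∪ L') f (fun β => ∑ δ ∈ (L \ L').powerset, q ^ apExp (L \ L') δ * G (β ∪ δ)) := by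
  induction hE with
  | @edge s t hst =>
    intro L hL
    -- L ⊆ {st}: the core is L itself, nothing is pruned
    refine ⟨L, le_rfl, ?_, ?_, ?_⟩
    · rcases Finset.subset_singleton_iff.1 hL with rfl | rfl
      · exact Or.inr rfl
      · exact Or.inl (IsTTSP.edge hst)
    · rw [Finset.sdiff_self, Finset.coe_empty]
      intro h
      have : (openGraph (∅ : BondConfig V)) = ⊥ := by
        unfold openGraph; exact SimpleGraph.fromEdgeSet_empty
      rw [this, SimpleGraph.reachable_bot] at h
      exact hst h
    · intro K VK _ _ _ f _ G
      rw [Finset.sdiff_self, fold_empty, apPsi_smul_right]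
  | @series E₁ E₂ a m b h₁ h₂ hd hV ha hb ih₁ ih₂ =>
    intro L hL
    have g₁ : ∀ e ∈ (↑E₁ : Set (Sym2 V)), ∀ z ∈ e, z ∈ {z : V | ∃ e ∈ E₁, z ∈ e} := fun e he z hz => ⟨e, he, hz⟩
    have g₂ : ∀ e ∈ (↑E₂ : Set (Sym2 V)), ∀ z ∈ e, z ∈ {z : V | ∃ e ∈ E₂, z ∈ e} := fun e he z hz => ⟨e, he, hz⟩
    have gS : {z : V | ∃ e ∈ E₁, z ∈ e} ∩ {z : V | ∃ e ∈ E₂, z ∈ e} ⊆ ({m} : Set V) := fun z hz => hV z hz.1 hz.2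
    have gaV₂ : a ∉ {z : V | ∃ e ∈ E₂, z ∈ e} := fun ⟨e, he, hae⟩ => ha e he hae
    have gbV₁ : b ∉ {z : V | ∃ e ∈ E₁, z ∈ e} := fun ⟨e, he, hbe⟩ => hb e he hbe
    have gam : a ≠ m := by
      obtain ⟨e, he, hme⟩ := h₂.left_mem
      intro ham; exact ha e he (ham ▸ hme)
    have gbm : b ≠ m := by
      obtain ⟨e, he, hme⟩ := h₁.right_mem
      intro hbm; exact hb e he (hbm ▸ hme)
    have gab : a ≠ b := by
      obtain ⟨e, he, hae⟩ := h₁.left_mem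
      intro hab; exact hb e he (hab ▸ hae)
    set L₁ := L ∩ E₁ with hL₁def
    set L₂ := L ∩ E₂ with hL₂def
    have hL₁ : L₁ ⊆ E₁ := Finset.inter_subset_right
    have hL₂ : L₂ ⊆ E₂ := Finset.inter_subset_right
    have hLeq : L = L₁ ∪ L₂ := by rw [← Finset.inter_union_distrib_left, Finset.inter_eq_left.2 hL]
    have hdL : Disjoint L₁ L₂ := Finset.disjoint_of_subset_left hL₁ (Finset.disjoint_of_subset_right hL₂ hd)
    obtain ⟨L₁', hL₁', hT₁, hnr₁, hF₁⟩ := ih₁ L₁ hL₁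
    obtain ⟨L₂', hL₂', hT₂, hnr₂, hF₂⟩ := ih₂ L₂ hL₂
    -- contexts for the two sides
    have ctx₁ : ∀ (K : Finset (Sym2 V)) (VK : Set V), Disjoint K (E₁ ∪ E₂) → (∀ e ∈ (↑K : Set (Sym2 V)), ∀ v ∈ e, v ∈ VK) →
        VK ∩ {v : V | ∃ e ∈ E₁ ∪ E₂, v ∈ e} ⊆ {a, b} → ∀ M₂ : Finset (Sym2 V), M₂ ⊆ E₂ →
        Disjoint (K ∪ M₂) E₁ ∧ (∀ e ∈ (↑(K ∪ M₂) : Set (Sym2 V)), ∀ v ∈ e, v ∈ VK ∪ {z : V | ∃ e ∈ E₂, z ∈ e}) ∧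
          (VK ∪ {z : V | ∃ e ∈ E₂, z ∈ e}) ∩ {v : V | ∃ e ∈ E₁, v ∈ e} ⊆ {a, m} := by
      intro K VK hK hVK hKS M₂ hM₂
      refine ⟨?_, ?_, ?_⟩
      · exact Finset.disjoint_union_left.2 ⟨Finset.disjoint_of_subset_right Finset.subset_union_left hK,
          Finset.disjoint_of_subset_left hM₂ hd.symm⟩
      · intro e he v hv
        rcases Finset.mem_union.1 (Finset.mem_coe.1 he) with heK | heM
        · exact Or.inl (hVK e (Finset.mem_coe.2 heK) v hv)
        · exact Or.inr ⟨e, hM₂ heM, hv⟩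
      · rintro v ⟨hv | hv, hv₁⟩
        · have hvab : v ∈ ({a, b} : Set V) := hKS ⟨hv, by
            obtain ⟨e, he, hve⟩ := hv₁; exact ⟨e, Finset.mem_union_left _ he, hve⟩⟩
          rcases hvab with rfl | rfl
          · exact Or.inl rfl
          · exact absurd hv₁ gbV₁
        · exact Or.inr (gS ⟨hv₁, hv⟩)
    have ctx₂ : ∀ (K : Finset (Sym2 V)) (VK : Set V), Disjoint K (E₁ ∪ E₂) → (∀ e ∈ (↑K : Set (Sym2 V)), ∀ v ∈ e, v ∈ VK) →
        VK ∩ {v : V | ∃ e ∈ E₁ ∪ E₂, v ∈ e} ⊆ {a, b} → ∀ M₁ : Finset (Sym2 V), M₁ ⊆ E₁ →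
        Disjoint (K ∪ M₁) E₂ ∧ (∀ e ∈ (↑(K ∪ M₁) : Set (Sym2 V)), ∀ v ∈ e, v ∈ VK ∪ {z : V | ∃ e ∈ E₁, z ∈ e}) ∧
          (VK ∪ {z : V | ∃ e ∈ E₁, z ∈ e}) ∩ {v : V | ∃ e ∈ E₂, v ∈ e} ⊆ {m, b} := by
      intro K VK hK hVK hKS M₁ hM₁
      refine ⟨?_, ?_, ?_⟩
      · exact Finset.disjoint_union_left.2 ⟨Finset.disjoint_of_subset_right Finset.subset_union_right hK,
          Finset.disjoint_of_subset_left hM₁ hd⟩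
      · intro e he v hv
        rcases Finset.mem_union.1 (Finset.mem_coe.1 he) with heK | heM
        · exact Or.inl (hVK e (Finset.mem_coe.2 heK) v hv)
        · exact Or.inr ⟨e, hM₁ heM, hv⟩
      · rintro v ⟨hv | hv, hv₂⟩
        · have hvab : v ∈ ({a, b} : Set V) := hKS ⟨hv, by
            obtain ⟨e, he, hve⟩ := hv₂; exact ⟨e, Finset.mem_union_right _ he, hve⟩⟩
          rcases hvab with rfl | rfl
          · exact absurd hv₂ gaV₂
          · exact Or.inr rfl
        · exact Or.inl (gS ⟨hv, hv₂⟩)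
    -- the context K meets E₁ only at a and E₂ only at b
    have ctxK₁ : ∀ (VK : Set V), VK ∩ {v : V | ∃ e ∈ E₁ ∪ E₂, v ∈ e} ⊆ {a, b} →
        VK ∩ {v : V | ∃ e ∈ E₁, v ∈ e} ⊆ {a} := by
      rintro VK hKS v ⟨hv, hv₁⟩
      have hvab : v ∈ ({a, b} : Set V) := hKS ⟨hv, by
        obtain ⟨e, he, hve⟩ := hv₁; exact ⟨e, Finset.mem_union_left _ he, hve⟩⟩
      rcases hvab with rfl | rfl
      · rfl
      · exact absurd hv₁ gbV₁
    have ctxK₂ : ∀ (VK : Set V), VK ∩ {v : V | ∃ e ∈ E₁ ∪ E₂, v ∈ e} ⊆ {a, b} →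
        VK ∩ {v : V | ∃ e ∈ E₂, v ∈ e} ⊆ {b} := by
      rintro VK hKS v ⟨hv, hv₂⟩
      have hvab : v ∈ ({a, b} : Set V) := hKS ⟨hv, by
        obtain ⟨e, he, hve⟩ := hv₂; exact ⟨e, Finset.mem_union_right _ he, hve⟩⟩
      rcases hvab with rfl | rfl
      · exact absurd hv₂ gaV₂
      · rfl
    rcases hT₁ with hT₁ | hT₁
    · rcases hT₂ with hT₂ | hT₂
      · -- both cores nonempty: the core of L is their series composition
        refine ⟨L₁' ∪ L₂', ?_, Or.inl ?_, ?_, ?_⟩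
        · rw [hLeq]; exact Finset.union_subset_union hL₁' hL₂'
        · exact IsTTSP.series hT₁ hT₂ (Finset.disjoint_of_subset_left hL₁' (Finset.disjoint_of_subset_right hL₂' hdL))
            (fun z hz₁ hz₂ => by
              obtain ⟨e, he, hze⟩ := hz₁; obtain ⟨e', he', hze'⟩ := hz₂
              exact hV z ⟨e, hL₁ (hL₁' he), hze⟩ ⟨e', hL₂ (hL₂' he'), hze'⟩)
            (fun e he => ha e (hL₂ (hL₂' he))) (fun e he => hb e (hL₁ (hL₁' he)))
        · have hP : L \ (L₁' ∪ L₂') = (L₁ \ L₁') ∪ (L₂ \ L₂') := by rw [hLeq]; exact union_sdiff_union hdL hL₁' hL₂'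
          rw [hP]
          intro h
          have := (reachable_union_series g₁ g₂ gS gaV₂ gbV₁ gam gbm gab (Finset.sdiff_subset.trans hL₁)
            (Finset.sdiff_subset.trans hL₂)).1 h
          exact hnr₁ this.1
        · intro K VK hK hVK hKS f hf G
          have hP : L \ (L₁' ∪ L₂') = (L₁ \ L₁') ∪ (L₂ \ L₂') := by rw [hLeq]; exact union_sdiff_union hdL hL₁' hL₂'
          obtain ⟨d₁, s₁, c₁⟩ := ctx₁ K VK hK hVK hKS L₂ hL₂
          obtain ⟨d₂, s₂, c₂⟩ := ctx₂ K VK hK hVK hKS L₁' (hL₁'.trans hL₁)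
          have e1 := hF₁ (K ∪ L₂) _ d₁ s₁ c₁ f (fun X Y hY => hf X Y (by rw [hP]; exact hY.trans Finset.subset_union_left)) G
          have e2 := hF₂ (K ∪ L₁') _ d₂ s₂ c₂ f (fun X Y hY => hf X Y (by rw [hP]; exact hY.trans Finset.subset_union_right))
            (fun β => ∑ δ ∈ (L₁ \ L₁').powerset, q ^ apExp (L₁ \ L₁') δ * G (β ∪ δ))
          have hKL : K ∪ L = K ∪ L₂ ∪ L₁ := by rw [hLeq, Finset.union_assoc, Finset.union_comm L₁ L₂]
          have hKL' : K ∪ L₂ ∪ L₁' = K ∪ L₁' ∪ L₂ := Finset.union_right_comm _ _ _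
          have hKL'' : K ∪ L₁' ∪ L₂' = K ∪ (L₁' ∪ L₂') := Finset.union_assoc _ _ _
          have ff := fold_fold q (Pa := L₁ \ L₁') (Pb := L₂ \ L₂') (Finset.disjoint_of_subset_left Finset.sdiff_subset
              (Finset.disjoint_of_subset_right Finset.sdiff_subset hdL))
            (apExp_add_oneSum hd g₁ g₂ gS (M₁ := L₁ \ L₁') (M₂ := L₂ \ L₂') (Finset.sdiff_subset.trans hL₁)
              (Finset.sdiff_subset.trans hL₂)) G
          have key : q ^ (2 * Fintype.card V) * (q ^ (2 * Fintype.card V) * apPsi q (K ∪ L) f G) =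
              q ^ (2 * Fintype.card V) * apPsi q (K ∪ (L₁' ∪ L₂')) f
                (fun β => ∑ δ ∈ (L \ (L₁' ∪ L₂')).powerset, q ^ apExp (L \ (L₁' ∪ L₂')) δ * G (β ∪ δ)) := by
            rw [hKL, e1, hKL', e2, hKL'', ff, apPsi_smul_right, hP]
          exact mul_left_cancel₀ (pow_ne_zero _ hq) key
      · -- the second core is empty: fold L₂ (ih₂), then L₁ hangs at `a` and folds away whole
        refine ⟨∅, Finset.empty_subset _, Or.inr rfl, ?_, ?_⟩
        · rw [Finset.sdiff_empty, hLeq]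
          intro h
          have := (reachable_union_series g₁ g₂ gS gaV₂ gbV₁ gam gbm gab hL₁ hL₂).1 h
          have h2 : (openGraph (↑(L₂ \ L₂') : BondConfig V)).Reachable m b := by rw [hT₂, Finset.sdiff_empty]; exact this.2
          exact hnr₂ h2
        · intro K VK hK hVK hKS f hf G
          rw [Finset.sdiff_empty] at hf ⊢
          obtain ⟨d₂, s₂, c₂⟩ := ctx₂ K VK hK hVK hKS L₁ hL₁
          have e2 := hF₂ (K ∪ L₁) _ d₂ s₂ c₂ f (fun X Y hY => hf X Y (by
            rw [hLeq]; exact (hY.trans Finset.sdiff_subset).trans Finset.subset_union_right)) G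
          rw [hT₂, Finset.sdiff_empty, Finset.union_empty] at e2
          have e1 := apPsi_fold_eq_of_add q (Finset.disjoint_of_subset_right hL₁
              (Finset.disjoint_of_subset_right Finset.subset_union_left hK))
            (apExp_add_oneSum (M₁ := K) (M₂ := L₁) (Finset.disjoint_of_subset_right Finset.subset_union_left hK) hVK g₁
              (ctxK₁ VK hKS) le_rfl hL₁)
            (f := f) (fun X Y hY => hf X Y (by rw [hLeq]; exact hY.trans Finset.subset_union_left))
            (fun β => ∑ δ ∈ L₂.powerset, q ^ apExp L₂ δ * G (β ∪ δ))
          have hKL : K ∪ L = K ∪ L₁ ∪ L₂ := by rw [hLeq, Finset.union_assoc]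
          have ff := fold_fold q hdL.symm (fun δa hδa δb hδb => by
            rw [Finset.union_comm L₂ L₁, Finset.union_comm δa δb]
            exact (apExp_add_oneSum hd g₁ g₂ gS hL₁ hL₂ δb hδb δa hδa).trans (add_comm _ _)) G
          have key : q ^ (2 * Fintype.card V) * (q ^ (2 * Fintype.card V) * apPsi q (K ∪ L) f G) =
              q ^ (2 * Fintype.card V) * apPsi q (K ∪ ∅) f
                (fun β => ∑ δ ∈ L.powerset, q ^ apExp L δ * G (β ∪ δ)) := by
            rw [hKL, e2, e1, ff, apPsi_smul_right, Finset.union_empty, Finset.union_comm L₂ L₁, ← hLeq]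
          exact mul_left_cancel₀ (pow_ne_zero _ hq) key
    · -- the first core is empty: fold L₁ (ih₁), then L₂ hangs at `b` and folds away whole
      refine ⟨∅, Finset.empty_subset _, Or.inr rfl, ?_, ?_⟩
      · rw [Finset.sdiff_empty, hLeq]
        intro h
        have := (reachable_union_series g₁ g₂ gS gaV₂ gbV₁ gam gbm gab hL₁ hL₂).1 h
        have h1 : (openGraph (↑(L₁ \ L₁') : BondConfig V)).Reachable a m := by rw [hT₁, Finset.sdiff_empty]; exact this.1
        exact hnr₁ h1
      · intro K VK hK hVK hKS f hf G
        rw [Finset.sdiff_empty] at hf ⊢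
        obtain ⟨d₁, s₁, c₁⟩ := ctx₁ K VK hK hVK hKS L₂ hL₂
        have e1 := hF₁ (K ∪ L₂) _ d₁ s₁ c₁ f (fun X Y hY => hf X Y (by
          rw [hLeq]; exact (hY.trans Finset.sdiff_subset).trans Finset.subset_union_left)) G
        rw [hT₁, Finset.sdiff_empty, Finset.union_empty] at e1
        have e2 := apPsi_fold_eq_of_add q (Finset.disjoint_of_subset_right hL₂
            (Finset.disjoint_of_subset_right Finset.subset_union_right hK))
          (apExp_add_oneSum (M₁ := K) (M₂ := L₂) (Finset.disjoint_of_subset_right Finset.subset_union_right hK) hVK g₂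
            (ctxK₂ VK hKS) le_rfl hL₂)
          (f := f) (fun X Y hY => hf X Y (by rw [hLeq]; exact hY.trans Finset.subset_union_right))
          (fun β => ∑ δ ∈ L₁.powerset, q ^ apExp L₁ δ * G (β ∪ δ))
        have hKL : K ∪ L = K ∪ L₂ ∪ L₁ := by rw [hLeq, Finset.union_assoc, Finset.union_comm L₁ L₂]
        have ff := fold_fold q hdL (apExp_add_oneSum hd g₁ g₂ gS hL₁ hL₂) G
        have key : q ^ (2 * Fintype.card V) * (q ^ (2 * Fintype.card V) * apPsi q (K ∪ L) f G) =
            q ^ (2 * Fintype.card V) * apPsi q (K ∪ ∅) f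
              (fun β => ∑ δ ∈ L.powerset, q ^ apExp L δ * G (β ∪ δ)) := by
          rw [hKL, e1, e2, ff, apPsi_smul_right, Finset.union_empty, ← hLeq]
        exact mul_left_cancel₀ (pow_ne_zero _ hq) key
  | @parallel E₁ E₂ s t h₁ h₂ hd hV ih₁ ih₂ =>
    intro L hL
    have g₁ : ∀ e ∈ (↑E₁ : Set (Sym2 V)), ∀ z ∈ e, z ∈ {z : V | ∃ e ∈ E₁, z ∈ e} := fun e he z hz => ⟨e, he, hz⟩
    have g₂ : ∀ e ∈ (↑E₂ : Set (Sym2 V)), ∀ z ∈ e, z ∈ {z : V | ∃ e ∈ E₂, z ∈ e} := fun e he z hz => ⟨e, he, hz⟩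
    have gS : {z : V | ∃ e ∈ E₁, z ∈ e} ∩ {z : V | ∃ e ∈ E₂, z ∈ e} ⊆ ({s, t} : Set V) := by
      intro z hz
      rcases hV z hz.1 hz.2 with h | h
      · exact Or.inl h
      · exact Or.inr h
    have gst : s ≠ t := h₁.ne
    set L₁ := L ∩ E₁ with hL₁def
    set L₂ := L ∩ E₂ with hL₂def
    have hL₁ : L₁ ⊆ E₁ := Finset.inter_subset_right
    have hL₂ : L₂ ⊆ E₂ := Finset.inter_subset_right
    have hLeq : L = L₁ ∪ L₂ := by rw [← Finset.inter_union_distrib_left, Finset.inter_eq_left.2 hL]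
    have hdL : Disjoint L₁ L₂ := Finset.disjoint_of_subset_left hL₁ (Finset.disjoint_of_subset_right hL₂ hd)
    obtain ⟨L₁', hL₁', hT₁, hnr₁, hF₁⟩ := ih₁ L₁ hL₁
    obtain ⟨L₂', hL₂', hT₂, hnr₂, hF₂⟩ := ih₂ L₂ hL₂
    have hP : L \ (L₁' ∪ L₂') = (L₁ \ L₁') ∪ (L₂ \ L₂') := by rw [hLeq]; exact union_sdiff_union hdL hL₁' hL₂'
    have ctx : ∀ (K : Finset (Sym2 V)) (VK : Set V), Disjoint K (E₁ ∪ E₂) → (∀ e ∈ (↑K : Set (Sym2 V)), ∀ v ∈ e, v ∈ VK) →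
        VK ∩ {v : V | ∃ e ∈ E₁ ∪ E₂, v ∈ e} ⊆ {s, t} →
        (∀ M₂ : Finset (Sym2 V), M₂ ⊆ E₂ →
          Disjoint (K ∪ M₂) E₁ ∧ (∀ e ∈ (↑(K ∪ M₂) : Set (Sym2 V)), ∀ v ∈ e, v ∈ VK ∪ {z : V | ∃ e ∈ E₂, z ∈ e}) ∧
            (VK ∪ {z : V | ∃ e ∈ E₂, z ∈ e}) ∩ {v : V | ∃ e ∈ E₁, v ∈ e} ⊆ {s, t}) ∧
        (∀ M₁ : Finset (Sym2 V), M₁ ⊆ E₁ →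
          Disjoint (K ∪ M₁) E₂ ∧ (∀ e ∈ (↑(K ∪ M₁) : Set (Sym2 V)), ∀ v ∈ e, v ∈ VK ∪ {z : V | ∃ e ∈ E₁, z ∈ e}) ∧
            (VK ∪ {z : V | ∃ e ∈ E₁, z ∈ e}) ∩ {v : V | ∃ e ∈ E₂, v ∈ e} ⊆ {s, t}) := by
      intro K VK hK hVK hKS
      refine ⟨fun M₂ hM₂ => ⟨?_, ?_, ?_⟩, fun M₁ hM₁ => ⟨?_, ?_, ?_⟩⟩
      · exact Finset.disjoint_union_left.2 ⟨Finset.disjoint_of_subset_right Finset.subset_union_left hK,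
          Finset.disjoint_of_subset_left hM₂ hd.symm⟩
      · intro e he v hv
        rcases Finset.mem_union.1 (Finset.mem_coe.1 he) with heK | heM
        · exact Or.inl (hVK e (Finset.mem_coe.2 heK) v hv)
        · exact Or.inr ⟨e, hM₂ heM, hv⟩
      · rintro v ⟨hv | hv, hv₁⟩
        · exact hKS ⟨hv, by obtain ⟨e, he, hve⟩ := hv₁; exact ⟨e, Finset.mem_union_left _ he, hve⟩⟩
        · exact gS ⟨hv₁, hv⟩
      · exact Finset.disjoint_union_left.2 ⟨Finset.disjoint_of_subset_right Finset.subset_union_right hK,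
          Finset.disjoint_of_subset_left hM₁ hd⟩
      · intro e he v hv
        rcases Finset.mem_union.1 (Finset.mem_coe.1 he) with heK | heM
        · exact Or.inl (hVK e (Finset.mem_coe.2 heK) v hv)
        · exact Or.inr ⟨e, hM₁ heM, hv⟩
      · rintro v ⟨hv | hv, hv₂⟩
        · exact hKS ⟨hv, by obtain ⟨e, he, hve⟩ := hv₂; exact ⟨e, Finset.mem_union_right _ he, hve⟩⟩
        · exact gS ⟨hv, hv₂⟩
    refine ⟨L₁' ∪ L₂', ?_, ?_, ?_, ?_⟩
    · rw [hLeq]; exact Finset.union_subset_union hL₁' hL₂'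
    · rcases hT₁ with hT₁ | hT₁ <;> rcases hT₂ with hT₂ | hT₂
      · exact Or.inl (IsTTSP.parallel hT₁ hT₂
          (Finset.disjoint_of_subset_left hL₁' (Finset.disjoint_of_subset_right hL₂' hdL))
          (fun z hz₁ hz₂ => by
            obtain ⟨e, he, hze⟩ := hz₁; obtain ⟨e', he', hze'⟩ := hz₂
            exact hV z ⟨e, hL₁ (hL₁' he), hze⟩ ⟨e', hL₂ (hL₂' he'), hze'⟩))
      · rw [hT₂, Finset.union_empty]; exact Or.inl hT₁
      · rw [hT₁, Finset.empty_union]; exact Or.inl hT₂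
      · rw [hT₁, hT₂, Finset.empty_union]; exact Or.inr rfl
    · rw [hP]
      intro h
      rcases (reachable_union_parallel g₁ g₂ gS (Finset.sdiff_subset.trans hL₁) (Finset.sdiff_subset.trans hL₂)).1 h
        with h | h
      · exact hnr₁ h
      · exact hnr₂ h
    · intro K VK hK hVK hKS f hf G
      obtain ⟨cx₁, cx₂⟩ := ctx K VK hK hVK hKS
      obtain ⟨d₁, s₁, c₁⟩ := cx₁ L₂ hL₂
      obtain ⟨d₂, s₂, c₂⟩ := cx₂ L₁' (hL₁'.trans hL₁)
      have e1 := hF₁ (K ∪ L₂) _ d₁ s₁ c₁ f (fun X Y hY => hf X Y (by rw [hP]; exact hY.trans Finset.subset_union_left)) G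
      have e2 := hF₂ (K ∪ L₁') _ d₂ s₂ c₂ f (fun X Y hY => hf X Y (by rw [hP]; exact hY.trans Finset.subset_union_right))
        (fun β => ∑ δ ∈ (L₁ \ L₁').powerset, q ^ apExp (L₁ \ L₁') δ * G (β ∪ δ))
      have hKL : K ∪ L = K ∪ L₂ ∪ L₁ := by rw [hLeq, Finset.union_assoc, Finset.union_comm L₁ L₂]
      have hKL' : K ∪ L₂ ∪ L₁' = K ∪ L₁' ∪ L₂ := Finset.union_right_comm _ _ _
      have hKL'' : K ∪ L₁' ∪ L₂' = K ∪ (L₁' ∪ L₂') := Finset.union_assoc _ _ _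
      have ff := fold_fold q (Pa := L₁ \ L₁') (Pb := L₂ \ L₂') (Finset.disjoint_of_subset_left Finset.sdiff_subset
          (Finset.disjoint_of_subset_right Finset.sdiff_subset hdL))
        (apExp_add_twoPoint hd g₁ g₂ gS gst (M₁ := L₁ \ L₁') (M₂ := L₂ \ L₂') (Finset.sdiff_subset.trans hL₁)
          (Finset.sdiff_subset.trans hL₂) hnr₂) G
      have key : q ^ (2 * Fintype.card V) * (q ^ (2 * Fintype.card V) * apPsi q (K ∪ L) f G) =
          q ^ (2 * Fintype.card V) * apPsi q (K ∪ (L₁' ∪ L₂')) f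
            (fun β => ∑ δ ∈ (L \ (L₁' ∪ L₂')).powerset, q ^ apExp (L \ (L₁' ∪ L₂')) δ * G (β ∪ δ)) := by
        rw [hKL, e1, hKL', e2, hKL'', ff, apPsi_smul_right, hP]
      exact mul_left_cancel₀ (pow_ne_zero _ hq) key

end Prune

end FK

end Summit.CriticalPhenomena.PercolationContinuityZ3.Theorems

end
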